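import Summits.KontsevichZagierPeriods.KontsevichZagierPeriods.Theorems.StuffleInKZ.Negative.AlgebraicShadow

/-!
# `StuffleInKZ` (stmt-KontsevichZagierPeriods-3931): negative side — the change-of-variables-free
# sub-calculus cannot swap coordinates; rule (2) is independent of rules (1) + (3)

Companion of `Negative/AlgebraicShadow.lean` (cdisprove unit of the crux `StuffleInKZ`, route
`FurushoPentagon`; cycle 3), which proves that every CoV-free relation
(`covFreeRelations = closure (domainAddRel ∪ integrandAddRel ∪ newtonLeibnizRel)`) has an
ALGEBRAIC SHADOW: its first-axis marginal `KZ.sliceEval` agrees a.e. with a `ℚ`-semialgebraic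
function. Here the witness and the consequences (0 sorry):

* §3 the coordinate SWAP between `boxRep₁ = [(0,1)×(1,2), dz/(z₀+z₁)]` and
  `boxRep₂ = [(1,2)×(0,1), dz/(z₀+z₁)]` is ONE change of variables
  (`swapWitness_mem_changeOfVariablesRel`), but the marginal of `[boxRep₁] − [boxRep₂]` on `(0,1)`
  is `L s = log (s+2) − log (s+1)` (`sliceEval_swapWitness`), which satisfies NO polynomial identity
  (`eq_zero_of_evalEval_L`: the tree's simple-pole descent
  `NoSemialgPrimKernel.eq_zero_of_evalEval_eq_zero` of the barrier file
  `AlgebraicPrimitivesObstruction.lean`, pole at `s = −1`), so the swap witness has no algebraic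
  shadow (`swapWitness_not_hasAlgShadow`);
* §4 `covFreeRelations_lt_relations` — rule (2) is INDEPENDENT of rules (1) + (3) (dual to
  `nlFreeRelations_lt_relations` of `NewtonLeibnizFree.lean`); `not_kernel_le_covFree` — the kernel
  conjecture FAILS for the CoV-free calculus; `swapWitness_not_mem_closure_fibred_nl` — a coordinate
  swap is not even generated by all FIBRED moves together with all Newton–Leibniz moves;
* §5 `stuffleInCovFree_imp_hasAlgShadow` — the crux in the CoV-free calculus forces an algebraic
  shadow on the first genuine defect `[Δ₂]² − 2[Δ_{2,2}] − [Δ₄]`, whose marginal on `(0,1)` is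
  `(ζ(2)·(−log(1−s)) − 2 Li_{1,2}(s) − Li₃(s))/s`, log-divergent at `s → 1⁻` hence not
  semialgebraic — the analytic verification of this last clause is NOT in this file (work file
  `Cruxes/StuffleInKZ/Disproof.lean`, §9).

Sources: M. Kontsevich, D. Zagier, *Periods* (2001), §1.2; J. Ayoub, *Une version relative de la
conjecture des périodes de Kontsevich–Zagier*, Ann. of Math. 181 (2015), Rem. 1.2, 1.5.
-/

noncomputable section

namespace Summit.KontsevichZagierPeriods.Theorems.StuffleInKZ.Negative

open MeasureTheory Set Filter
open Literature.NumberTheory.Transcendental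
open Literature.NumberTheory.Transcendental.KZ
open Literature.ModelTheory.ExponentialFields (IsSemialgebraic isSemialgebraic_univ
  isSemialgebraic_setOf_eval_pos isSemialgebraic_setOf_eval_eq_zero isSemialgebraic_setOf_eval_le)
open MvPolynomial (aeval X C)
open Literature.NumberTheory.Transcendental.MZV (IsAdmissible stuffle)
open Summit.KontsevichZagierPeriods.KontsevichZagierPeriods.Theses.FurushoPentagon (StuffleInKZ)

variable {n m : ℕ}

/-! ## §3 The witness: a coordinate swap

`boxRep₁ = [(0,1) × (1,2), dz/(z₀ + z₁)]`, `boxRep₂ = [(1,2) × (0,1), dz/(z₀ + z₁)]`; the swap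
`(z₀, z₁) ↦ (z₁, z₀)` is ONE change of variables between them, but their first-axis marginals on
`(0,1)` are `log((s+2)/(s+1))` and `0`. -/

namespace Swap

/-- The open box `(a,b) × (c,d) ⊆ ℝ²` with rational corners. -/
def box (a b c d : ℚ) : Set (Fin 2 → ℝ) :=
  {z | (a : ℝ) < z 0 ∧ z 0 < b ∧ (c : ℝ) < z 1 ∧ z 1 < d}

/-- Rational boxes are `ℚ`-semialgebraic. [folklore] -/
theorem isSemialgebraic_box (a b c d : ℚ) : IsSemialgebraic ℚ (box a b c d) := by
  have h1 : IsSemialgebraic ℚ {z : Fin 2 → ℝ | 0 < aeval z (X 0 - C a : MvPolynomial (Fin 2) ℚ)} :=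
    isSemialgebraic_setOf_eval_pos _
  have h2 : IsSemialgebraic ℚ {z : Fin 2 → ℝ | 0 < aeval z (C b - X 0 : MvPolynomial (Fin 2) ℚ)} :=
    isSemialgebraic_setOf_eval_pos _
  have h3 : IsSemialgebraic ℚ {z : Fin 2 → ℝ | 0 < aeval z (X 1 - C c : MvPolynomial (Fin 2) ℚ)} :=
    isSemialgebraic_setOf_eval_pos _
  have h4 : IsSemialgebraic ℚ {z : Fin 2 → ℝ | 0 < aeval z (C d - X 1 : MvPolynomial (Fin 2) ℚ)} :=
    isSemialgebraic_setOf_eval_pos _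
  convert ((h1.inter h2).inter h3).inter h4 using 1
  ext z
  simp only [box, mem_setOf_eq, mem_inter_iff, map_sub, MvPolynomial.aeval_X, MvPolynomial.aeval_C,
    eq_ratCast, sub_pos]
  tauto

/-- Boxes are open. [folklore] -/
theorem isOpen_box (a b c d : ℚ) : IsOpen (box a b c d) := by
  have e : box a b c d = {z : Fin 2 → ℝ | (a : ℝ) < z 0} ∩ {z | z 0 < b} ∩ {z | (c : ℝ) < z 1} ∩
      {z | z 1 < d} := by
    ext z; simp [box, and_assoc]
  rw [e]
  exact (((isOpen_lt continuous_const (continuous_apply 0)).inter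
    (isOpen_lt (continuous_apply 0) continuous_const)).inter
    (isOpen_lt continuous_const (continuous_apply 1))).inter
    (isOpen_lt (continuous_apply 1) continuous_const)

/-- Boxes are measurable. [folklore] -/
theorem measurableSet_box (a b c d : ℚ) : MeasurableSet (box a b c d) :=
  (isOpen_box a b c d).measurableSet

/-- A box with corners in `[0, 2]` lies in the closed ball of radius `2`. -/
theorem box_subset_closedBall {a b c d : ℚ} (ha : 0 ≤ a) (hb : b ≤ 2) (hc : 0 ≤ c) (hd : d ≤ 2) :
    box a b c d ⊆ Metric.closedBall (0 : Fin 2 → ℝ) 2 := by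
  intro z hz
  rw [mem_closedBall_zero_iff, pi_norm_le_iff_of_nonneg (by norm_num)]
  intro i
  obtain ⟨h0a, h0b, h1c, h1d⟩ := hz
  have ha' : (0 : ℝ) ≤ a := by exact_mod_cast ha
  have hb' : (b : ℝ) ≤ 2 := by exact_mod_cast hb
  have hc' : (0 : ℝ) ≤ c := by exact_mod_cast hc
  have hd' : (d : ℝ) ≤ 2 := by exact_mod_cast hd
  rw [Real.norm_eq_abs, abs_le]
  fin_cases i
  · simp only [Fin.zero_eta]
    constructor <;> linarith
  · simp only [Fin.mk_one]
    constructor <;> linarith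

/-- The integrand `1/(z₀ + z₁)`. -/
def invSum (z : Fin 2 → ℝ) : ℝ := 1 / (z 0 + z 1)

/-- `1/(z₀+z₁)` is measurable. [folklore] -/
theorem measurable_invSum : Measurable invSum :=
  measurable_const.div ((measurable_pi_apply 0).add (measurable_pi_apply 1))

/-- The representation `[box, dz/(z₀+z₁)]` for a box inside `(0,2)²` off the antidiagonal. -/
def boxRep (a b c d : ℚ) (ha : 0 ≤ a) (hb : b ≤ 2) (hc : 0 ≤ c) (hd : d ≤ 2) (hac : 1 ≤ a + c) :
    IntegralRep 2 where
  domain := box a b c d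
  integrand := invSum
  isSemialgebraic_domain := isSemialgebraic_box a b c d
  isSemialgebraicFunOn_integrand := by
    have hq : ∀ z ∈ box a b c d, aeval z (X 0 + X 1 : MvPolynomial (Fin 2) ℚ) ≠ 0 := by
      intro z hz
      obtain ⟨h0a, -, h1c, -⟩ := hz
      have ha' : (0 : ℝ) ≤ a := by exact_mod_cast ha
      have hc' : (0 : ℝ) ≤ c := by exact_mod_cast hc
      simp only [map_add, MvPolynomial.aeval_X]
      intro h
      linarith
    refine (isSemialgebraicFunOn_aeval_div_aeval (isSemialgebraic_box a b c d)
      (1 : MvPolynomial (Fin 2) ℚ) (X 0 + X 1) hq).congr fun z _ => ?_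
    simp [invSum]
  integrableOn := by
    refine Measure.integrableOn_of_bounded (M := 1) ?_ measurable_invSum.aestronglyMeasurable ?_
    · exact (lt_of_le_of_lt (measure_mono (box_subset_closedBall ha hb hc hd))
        (measure_closedBall_lt_top)).ne
    · rw [ae_restrict_iff' (measurableSet_box a b c d)]
      refine Eventually.of_forall fun z hz => ?_
      obtain ⟨h0a, -, h1c, -⟩ := hz
      have ha' : (a : ℝ) + c ≥ 1 := by exact_mod_cast hac
      have hpos : 1 ≤ z 0 + z 1 := by linarith
      rw [invSum, Real.norm_eq_abs, abs_of_pos (by positivity)]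
      exact (div_le_one (by linarith)).mpr hpos

/-- `[(0,1) × (1,2), dz/(z₀+z₁)]`. -/
def boxRep₁ : IntegralRep 2 :=
  boxRep 0 1 1 2 (by norm_num) (by norm_num) (by norm_num) (by norm_num) (by norm_num)

/-- `[(1,2) × (0,1), dz/(z₀+z₁)]`. -/
def boxRep₂ : IntegralRep 2 :=
  boxRep 1 2 0 1 (by norm_num) (by norm_num) (by norm_num) (by norm_num) (by norm_num)

/-- Domain of `boxRep₁`. [folklore] -/
@[simp] theorem boxRep₁_domain : boxRep₁.domain = box 0 1 1 2 := rfl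

/-- Domain of `boxRep₂`. [folklore] -/
@[simp] theorem boxRep₂_domain : boxRep₂.domain = box 1 2 0 1 := rfl

/-- Integrand of `boxRep₁`. [folklore] -/
@[simp] theorem boxRep₁_integrand : boxRep₁.integrand = invSum := rfl

/-- Integrand of `boxRep₂`. [folklore] -/
@[simp] theorem boxRep₂_integrand : boxRep₂.integrand = invSum := rfl

/-- The swap matrix. -/
def Jswap : Matrix (Fin 2) (Fin 2) ℝ := !![0, 1; 1, 0]

/-- The coordinate swap as a continuous linear map. -/
def swapL : (Fin 2 → ℝ) →L[ℝ] (Fin 2 → ℝ) := LinearMap.toContinuousLinearMap (Matrix.toLin' Jswap)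

/-- The swap swaps. [folklore] -/
theorem swapL_apply (z : Fin 2 → ℝ) : swapL z = ![z 1, z 0] := by
  change Matrix.toLin' Jswap z = _
  rw [Matrix.toLin'_apply]
  ext i
  fin_cases i <;> simp [Jswap, Matrix.mulVec, dotProduct, Fin.sum_univ_two]

/-- First coordinate of the swap. [folklore] -/
@[simp] theorem swapL_apply_zero (z : Fin 2 → ℝ) : swapL z 0 = z 1 := by
  rw [swapL_apply]; rfl

/-- Second coordinate of the swap. [folklore] -/
@[simp] theorem swapL_apply_one (z : Fin 2 → ℝ) : swapL z 1 = z 0 := by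
  rw [swapL_apply]; rfl

/-- `det (swap) = −1`. [folklore] -/
theorem det_swapL : swapL.det = -1 := by
  change LinearMap.det (Matrix.toLin' Jswap) = _
  rw [LinearMap.det_toLin', Jswap, Matrix.det_fin_two_of]
  ring

/-- The swap is an involution. [folklore] -/
theorem swapL_swapL (z : Fin 2 → ℝ) : swapL (swapL z) = z := by
  ext i
  fin_cases i <;> simp

/-- The swap as a polynomial map. -/
def Pswap : Fin 2 → MvPolynomial (Fin 2) ℚ := ![X 1, X 0]

/-- The swap is a polynomial map over `ℚ`. [folklore] -/
theorem swapL_eq_aeval : (swapL : (Fin 2 → ℝ) → (Fin 2 → ℝ)) = fun z j => aeval z (Pswap j) := by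
  funext z j
  fin_cases j <;> simp [Pswap]

/-- The swap of a box is the transposed box. [folklore] -/
theorem swapL_image_box (a b c d : ℚ) : swapL '' box a b c d = box c d a b := by
  ext z
  constructor
  · rintro ⟨w, hw, rfl⟩
    obtain ⟨h1, h2, h3, h4⟩ := hw
    exact ⟨by simpa using h3, by simpa using h4, by simpa using h1, by simpa using h2⟩
  · intro hz
    obtain ⟨h1, h2, h3, h4⟩ := hz
    exact ⟨swapL z, ⟨by simpa using h3, by simpa using h4, by simpa using h1, by simpa using h2⟩,
      swapL_swapL z⟩

/-- **The swap is ONE change of variables**: `[boxRep₁] − [boxRep₂] ∈ changeOfVariablesRel`. -/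
theorem swapWitness_mem_changeOfVariablesRel : of boxRep₁ - of boxRep₂ ∈ changeOfVariablesRel := by
  refine ⟨2, boxRep₁, boxRep₂, swapL, fun _ => swapL, ?_, ?_, ?_, ?_, ?_, rfl⟩
  · rw [swapL_eq_aeval]
    exact isSemialgebraicMapOn_aeval (isSemialgebraic_box 0 1 1 2) Pswap
  · intro x _
    exact swapL.hasFDerivAt.hasFDerivWithinAt
  · intro x _ y _ h
    rw [← swapL_swapL x, ← swapL_swapL y, h]
  · rw [boxRep₁_domain, boxRep₂_domain, swapL_image_box]
  · intro x _
    rw [det_swapL, boxRep₁_integrand, boxRep₂_integrand, invSum, invSum]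
    simp [add_comm]

/-- The swap witness is a relation. -/
theorem swapWitness_mem_relations : of boxRep₁ - of boxRep₂ ∈ relations :=
  changeOfVariablesRel_subset_relations swapWitness_mem_changeOfVariablesRel

/-- … of evaluation `0`. -/
theorem eval_swapWitness : eval (of boxRep₁ - of boxRep₂) = 0 :=
  relations_le_ker_eval_holds swapWitness_mem_relations

/-! ### The marginals on `(0,1)` -/

/-- `∫_{(1,2)} dt/(s+t) = log (s+2) − log (s+1)` for `s > −1`, as an integral over `ℝ¹`. -/
theorem setIntegral_fin_one_inv_add {s : ℝ} (hs : -1 < s) :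
    ∫ x in {x : Fin 1 → ℝ | (1 : ℝ) < x 0 ∧ x 0 < 2}, 1 / (s + x 0) =
      Real.log (s + 2) - Real.log (s + 1) := by
  have hmp := volume_preserving_funUnique (Fin 1) ℝ
  have hset : {x : Fin 1 → ℝ | (1 : ℝ) < x 0 ∧ x 0 < 2} =
      (MeasurableEquiv.funUnique (Fin 1) ℝ) ⁻¹' Ioo 1 2 := by
    ext x
    simp [MeasurableEquiv.funUnique]
  have hfun : (fun x : Fin 1 → ℝ => 1 / (s + x 0)) =
      fun x => (fun y : ℝ => 1 / (s + y)) (MeasurableEquiv.funUnique (Fin 1) ℝ x) := by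
    funext x
    rfl
  rw [hset, hfun]
  refine (hmp.setIntegral_preimage_emb (MeasurableEquiv.funUnique (Fin 1) ℝ).measurableEmbedding
    (fun y : ℝ => 1 / (s + y)) (Ioo 1 2)).trans ?_
  rw [← intervalIntegral.integral_of_le one_le_two |>.trans (integral_Ioc_eq_integral_Ioo),
    intervalIntegral.integral_comp_add_left (fun u => 1 / u) s]
  simp_rw [one_div]
  rw [integral_inv_of_pos (by linarith) (by linarith), Real.log_div (by linarith) (by linarith)]

/-- **Marginal of `boxRep₁` on `(0,1)`**: `log (s+2) − log (s+1)`. -/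
theorem sliceValue_boxRep₁ {s : ℝ} (hs : s ∈ Ioo (0 : ℝ) 1) :
    sliceValue boxRep₁ s = Real.log (s + 2) - Real.log (s + 1) := by
  rw [sliceValue_def, boxRep₁_domain, boxRep₁_integrand]
  have hset : {x : Fin 1 → ℝ | Matrix.vecCons s x ∈ box 0 1 1 2} =
      {x : Fin 1 → ℝ | (1 : ℝ) < x 0 ∧ x 0 < 2} := by
    ext x
    simp only [box, mem_setOf_eq, Matrix.cons_val_zero, Matrix.cons_val_one, Rat.cast_zero,
      Rat.cast_one, Rat.cast_ofNat]
    exact ⟨fun h => ⟨h.2.2.1, h.2.2.2⟩, fun h => ⟨hs.1, hs.2, h.1, h.2⟩⟩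
  rw [hset]
  have hfun : (fun x : Fin 1 → ℝ => invSum (Matrix.vecCons s x)) = fun x => 1 / (s + x 0) := by
    funext x
    simp [invSum]
  rw [hfun]
  exact setIntegral_fin_one_inv_add (by linarith [hs.1])

/-- **Marginal of `boxRep₂` on `(0,1)`**: `0` (empty slice). -/
theorem sliceValue_boxRep₂ {s : ℝ} (hs : s ∈ Ioo (0 : ℝ) 1) : sliceValue boxRep₂ s = 0 := by
  rw [sliceValue_def, boxRep₂_domain]
  have hset : {x : Fin 1 → ℝ | Matrix.vecCons s x ∈ box 1 2 0 1} = ∅ := by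
    ext x
    simp only [box, mem_setOf_eq, Matrix.cons_val_zero, Rat.cast_one, mem_empty_iff_false,
      iff_false, not_and]
    intro h1
    linarith [hs.2]
  rw [hset, Measure.restrict_empty, integral_zero_measure]

/-- The marginal of the swap witness on `(0,1)`. -/
theorem sliceEval_swapWitness {s : ℝ} (hs : s ∈ Ioo (0 : ℝ) 1) :
    sliceEval (of boxRep₁ - of boxRep₂) s = Real.log (s + 2) - Real.log (s + 1) := by
  rw [map_sub, sliceEval_of, sliceEval_of, Pi.sub_apply, sliceValue_boxRep₁ hs,
    sliceValue_boxRep₂ hs, sub_zero]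

/-- **The swap witness has NO algebraic shadow** (its marginal on `(0,1)` is `L`,
`LogShadow.not_hasAlgShadow_of_ae_eq_L`). -/
theorem swapWitness_not_hasAlgShadow : ¬ HasAlgShadow (of boxRep₁ - of boxRep₂) :=
  LogShadow.not_hasAlgShadow_of_ae_eq_L (Eventually.of_forall fun _ hs => sliceEval_swapWitness hs)

end Swap

/-! ## §4 Consequences: rule (2) is independent; the kernel conjecture fails CoV-free -/

open Swap in
/-- **The swap witness is not a CoV-free relation.** -/
theorem swapWitness_not_mem_covFreeRelations : of boxRep₁ - of boxRep₂ ∉ covFreeRelations :=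
  fun h => swapWitness_not_hasAlgShadow (covFreeRelations_le_algShadow h)

open Swap in
/-- Stronger: **a coordinate swap is not generated by fibred moves and Newton–Leibniz moves.** -/
theorem swapWitness_not_mem_closure_fibred_nl :
    of boxRep₁ - of boxRep₂ ∉ AddSubgroup.closure (fibredGenerators ∪ newtonLeibnizRel) :=
  fun h => swapWitness_not_hasAlgShadow (closure_fibred_nl_le_algShadow h)

open Swap in
/-- **Rule (2) is independent of rules (1), (3)**: the CoV-free closure is a PROPER subgroup of
`relations`. -/
theorem covFreeRelations_lt_relations : covFreeRelations < relations :=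
  lt_of_le_of_ne covFreeRelations_le_relations fun h =>
    swapWitness_not_mem_covFreeRelations (h ▸ swapWitness_mem_relations)

open Swap in
/-- The change-of-variables move set is not contained in the CoV-free closure. -/
theorem changeOfVariablesRel_not_subset_covFreeRelations :
    ¬ (changeOfVariablesRel ⊆ (covFreeRelations : Set FormalRep)) :=
  fun h => swapWitness_not_mem_covFreeRelations (h swapWitness_mem_changeOfVariablesRel)

open Swap in
/-- **The kernel conjecture FAILS for the CoV-free calculus**: the swap witness evaluates to `0`
but is not a CoV-free relation. -/
theorem not_kernel_le_covFree : ¬ ∀ c : FormalRep, eval c = 0 → c ∈ covFreeRelations :=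
  fun h => swapWitness_not_mem_covFreeRelations (h _ eval_swapWitness)

/-! ## §5 The crux in the CoV-free calculus -/

/-- The crux with `relations` replaced by the CoV-free closure (1a) + (1b) + (3). -/
def StuffleInCovFree : Prop :=
  ∀ Z : List ℕ → FormalRep, (∀ (u : List ℕ) (hu : IsAdmissible u), Z u = simplexOf u hu) →
    ∀ s t, IsAdmissible s → IsAdmissible t → defect Z s t ∈ covFreeRelations

/-- `Zcan` is pinned. [folklore] -/
theorem isPinned_Zcan' : ∀ (u : List ℕ) (hu : IsAdmissible u), Zcan u = simplexOf u hu :=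
  fun u hu => Zcan_of_isAdmissible u hu

/-- **Reduction**: the crux in the CoV-free calculus forces an algebraic shadow on the first
genuine defect `[Δ₂]² − 2[Δ_{2,2}] − [Δ₄]`, i.e. its first-axis marginal — on `(0,1)` the function
`(ζ(2)·(−log (1−s)) − 2·Li_{1,2}(s) − Li₃(s))/s`, `Li_{1,2}(s) = Σ_{n>m} sⁿ/(n m²)`, log-divergent as
`s → 1⁻` — would agree a.e. with a `ℚ`-semialgebraic function. -/
theorem stuffleInCovFree_imp_hasAlgShadow (h : StuffleInCovFree) :
    HasAlgShadow (defect Zcan [2] [2]) :=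
  covFreeRelations_le_algShadow (h Zcan isPinned_Zcan' [2] [2] (by decide) (by decide))

end Summit.KontsevichZagierPeriods.Theorems.StuffleInKZ.Negative
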